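import Summits.QuantumFields.QCD.Theses.SpectralDefectExtinction
import Literature.MathematicalPhysics.QuantumFieldTheory.QCDPhaseQuenched
import Literature.MathematicalPhysics.QuantumFieldTheory.SpectralDefectDensity
import Literature.Barriers.QuantumFields.WilsonDeterminantMassSplitting
import Summits.QuantumFields.QCD.Theorems.SpectralDefectExtinctionWegnerEstimateStubSchurComplement
import Summits.QuantumFields.QCD.Theorems.SpectralDefectExtinctionWegnerEstimateStubCellAverageBound

/-!
# Stub `sigmaTraceContinuous` of line `Sketch` (skeleton "ResolventCell") for crux
`SpectralDefectExtinction.WegnerEstimate` (item stmt-QuantumFields-8966)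

After exterior elimination the local resolvent trace at a site `x` of the Hermitian Wilson–Dirac
matrix `H(W) = Γ₅ D_W(W, m₀, 1)` is dressed by a dissipative self-energy `S` (`Im S ≥ 0`, encoded as
`(i (Sᴴ − S))` positive semidefinite):

  `F(V) = Σ_{a,α} Im ((H(glue U V) − iε − S)⁻¹)_{(x,a,α),(x,a,α)}`,

where `glue U V` reads the cell links (edges based in the cube `x + proj_L (box 4 R)`) from `V` and
the exterior links from `U`.  We show `F` is continuous in `V`: the dressed matrix
`V ↦ H(glue U V) − iε•1 − S` is continuous (the glue is continuous, `cellAverage_continuous_glue`,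
and `H` is polynomial in the links, `continuous_wilsonDirac`) and invertible for EVERY `V`
(`schurComplement_det_ne_zero`: for `v ≠ 0`, `Im (v⋆ (H − iε − S) v) = −ε‖v‖² − Im (v⋆ S v) < 0`),
and matrix inversion is continuous at invertible matrices (`continuousAt_matrix_inv`).
-/

noncomputable section

namespace Summit.QuantumFields.QCD.Cruxes.WegnerEstimate.ResolventCell

open MeasureTheory
open scoped Matrix BigOperators
open Literature.MathematicalPhysics.QuantumLattice Literature.MathematicalPhysics.QuantumFieldTheory
  Literature.Probability.LatticeModels
open Literature.Barriers.QuantumFields (isHermitian_gammaFive_mul_wilsonDirac)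
open Matrix
open scoped ComplexOrder

/-- **Dissipativity, pointwise form.**  If `i (Sᴴ − S)` is positive semidefinite then
`Im (v⋆ S v) ≥ 0` for every vector `v` (`v⋆ (i (Sᴴ − S)) v = 2 Im (v⋆ S v)`). -/
theorem sigmaTraceContinuous_im_nonneg {m : Type*} [Fintype m] {S : Matrix m m ℂ}
    (hS : (Complex.I • (Sᴴ - S)).PosSemidef) (v : m → ℂ) : 0 ≤ (star v ⬝ᵥ S *ᵥ v).im := by
  have h := hS.dotProduct_mulVec_nonneg v
  rw [schurComplement_quadForm_dissipator, Complex.zero_le_real] at h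
  exact nonneg_of_mul_nonneg_right h two_pos

/-- **Continuity of a dissipatively dressed resolvent.**  If `H : Y → Matrix n n ℂ` is continuous
with Hermitian values, `g : X → Y` is continuous, `Im (v⋆ S v) ≥ 0` for all `v` and `ε > 0`, then
`w ↦ (H (g w) − iε•1 − S)⁻¹` is continuous (the dressed matrix is everywhere invertible by
`schurComplement_det_ne_zero`, and `Ring.inverse` is continuous at units of `ℂ`). -/
theorem sigmaTraceContinuous_resolvent {X Y : Type*} [TopologicalSpace X] [TopologicalSpace Y]
    {n : Type*} [Fintype n] [DecidableEq n] {H : Y → Matrix n n ℂ} (hH : Continuous H)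
    (hHerm : ∀ y, (H y).IsHermitian) {g : X → Y} (hg : Continuous g) {S : Matrix n n ℂ}
    (hS : ∀ v : n → ℂ, 0 ≤ (star v ⬝ᵥ S *ᵥ v).im) {ε : ℝ} (hε : 0 < ε) :
    Continuous fun w => (H (g w) - ((ε : ℂ) * Complex.I) • (1 : Matrix n n ℂ) - S)⁻¹ := by
  have hB : Continuous fun w => H (g w) - ((ε : ℂ) * Complex.I) • (1 : Matrix n n ℂ) - S :=
    ((hH.comp hg).sub continuous_const).sub continuous_const
  exact continuous_iff_continuousAt.2 fun w =>
    (continuousAt_matrix_inv _ (by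
      rw [Ring.inverse_eq_inv']
      exact continuousAt_inv₀ (schurComplement_det_ne_zero (hHerm (g w)) hS hε))).comp hB.continuousAt

/-- **Stub `sigmaTraceContinuous` (regularity of the dressed local trace).**  For a dissipative
self-energy `S` (`i (Sᴴ − S) ≥ 0`) and `ε > 0`, the `S`-dressed local resolvent trace
`V ↦ Σ_{a,α} Im ((Γ₅ D_W(glue U V) − iε − S)⁻¹)_{(x,a,α),(x,a,α)}` is continuous in the cell links `V`
(the dressed matrix depends continuously on `V` and has quadratic form with imaginary part
`≤ −ε‖v‖²`, hence is invertible everywhere; inversion is continuous at invertible matrices). -/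
theorem stub_sigmaTraceContinuous (L : ℕ) [NeZero L] (R : ℕ) (x : TorusSite 4 L) (U : GaugeConfig 4 L SU3)
    (S : Matrix (QuarkIdx L) (QuarkIdx L) ℂ) (hS : (Complex.I • (Sᴴ - S)).PosSemidef) (m₀ ε : ℝ)
    (hε : 0 < ε) :
    Continuous fun V : GaugeConfig 4 L SU3 => ∑ a : Fin 3, ∑ α : Fin 4,
      (((spinorLift gammaFive * wilsonDirac (fundamentalRep (Fin 3))
          (fun e => if (∃ y ∈ box 4 R, e.1 = x + Torus.proj L y) then V e else U e) m₀ 1 -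
        ((ε : ℂ) * Complex.I) • (1 : Matrix (QuarkIdx L) (QuarkIdx L) ℂ) - S)⁻¹ :
          Matrix (QuarkIdx L) (QuarkIdx L) ℂ) (x, a, α) (x, a, α)).im := by
  -- the glued configuration is continuous in the cell links `V`
  have hglue : Continuous fun V : GaugeConfig 4 L SU3 =>
      (fun e => if (∃ y ∈ box 4 R, e.1 = x + Torus.proj L y) then V e else U e :
        GaugeConfig 4 L SU3) :=
    (cellAverage_continuous_glue (L := L)
      (fun e : Edge 4 L => ∃ y ∈ box 4 R, e.1 = x + Torus.proj L y)).comp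
      (Continuous.prodMk_right U)
  -- the Hermitian Wilson–Dirac matrix is continuous in the gauge field
  have hH : Continuous fun W : GaugeConfig 4 L SU3 =>
      spinorLift gammaFive * wilsonDirac (fundamentalRep (Fin 3)) W m₀ 1 :=
    continuous_const.mul (continuous_wilsonDirac (fundamentalRep (Fin 3))
      (continuous_fundamentalRep (Fin 3)) m₀ 1)
  have hHerm : ∀ W : GaugeConfig 4 L SU3,
      (spinorLift gammaFive * wilsonDirac (fundamentalRep (Fin 3)) W m₀ 1).IsHermitian :=
    fun W => isHermitian_gammaFive_mul_wilsonDirac (fundamentalRep (Fin 3))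
      fundamentalRep_mem_unitaryGroup W m₀ 1
  -- the dressed resolvent of the glued configuration is continuous in `V`
  have hR := sigmaTraceContinuous_resolvent hH hHerm hglue (sigmaTraceContinuous_im_nonneg hS) hε
  exact continuous_finsetSum _ fun a _ => continuous_finsetSum _ fun α _ =>
    Complex.continuous_im.comp (hR.matrix_elem _ _)

end Summit.QuantumFields.QCD.Cruxes.WegnerEstimate.ResolventCell

end
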